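/- Copyright: the b2b-balaban cell (near-miss cell 7), T⁴-continuum fan-out; row NE7b CRUX team (2), seat
t4-ne7b-formalise-leaf-02 (gen 28; the row owner's INTERFACE REQUEST NE7b IR-45-1 «→ S12-W crew (leaf-03 custodian; E-side
leaf-02; leaf-05)», HOME/INBOX.md l.8656–8665, as RE-SPECIFIED by RULING R-OWNER-46-1 «M5-4 THE FIBRE READING» (`CLAIMS.log`
l.31568: `FcM := LIVE` read on the key, `RfM := MULT`); E-side supplier brick B′ under the located findings F-ne7bleaf02g28-1
(l.31462) and F-ne7bleaf02g28-2 (l.31620)).  Released under the licence of the surrounding project. -/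
import Summits.QuantumFields.BalabanUV.T4Continuum.Support.HistoryPriceNodeSum
import Summits.QuantumFields.BalabanUV.T4Continuum.Support.HistoryAssemblyMultKey

/-!
# The LIVE product and the FIBRE MULTIPLICITY of a KEY FAMILY; the `priceM` sentence from a per-member charge
(INTERFACE REQUEST NE7b IR-45-1 under R-OWNER-46-1, E-side, module B′)

Summits-side support leaf of the T⁴-continuum cell (rung (B)+1 on a FINITE torus only; NOT infinite volume, NOT the
mass gap, NOT the Clay statement; NOT a proof of the spine estimate NE7b, which is the cell's OWN estimate, NOT PRINTED
and NOT PROVED).  Row NE7b, route «COUNT» ∕ R-P1, re-open object (α): the supplier plug of the VS-witness's H3 fields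
`FcM` ∕ `RfM` ∕ `priceM` (`HistoryRealiseCellsRunApexT3bWTVS.CountRoadWitnessT3bWTVS`, p265435) over M2 brick B.
[folklore] elementary bookkeeping; no `[cite:]` tag, nothing printed asserted, no `Prop` fact minted, zero `sorry`.

WHY.  R-OWNER-46-1 sets `FcM K k := LIVE K k` (M2 brick B's live product READ ON THE KEY) and `RfM K k := MULT K k`
(a product of `exp` of node sums of a displayed per-event fibre share), with `priceM` = «`LIVE · MULT ≤ PRICE` member by
member».  Two located typing points shape the reading: (F-ne7bleaf02g28-1) the key's genealogy letter is the FLAT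
`gen c = gmap Prod.fst (genT c)`, on which only NODE SUMS (module A, `HistoryPriceNodeSum`) read the tagged event
functionals correctly; (F-ne7bleaf02g28-2) brick B's true live factor contains `evProd (fB K) (fR K) (toPGen …)` whose
birth letters carry the REGION (`fB K j d′ n`, `n : Lab d`) — not a datum of the flat key — so the key-readable live
product is the one ONE STEP UP the owner's chain, at the SHARP letters: for a member `G` (tagged, shape map `sh`),
`LIVE♯(G) = e^{lifeCost (dictWT sh R C.n₁) (costT sh C K R) G} · e^{birthWT sh u G} · e^{−credits (σ ∘ sh) G}` with `σ` the
sharp per-letter table (at the witness `σ := sharpT (sB K) (sR K)`; `LIVE_true ≤ LIVE♯` is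
`HistoryBankingCreditRead.evProd_le_exp_neg_sharps` under `FactorRead`, used by the custodian's `upM`).  THIS FILE is
GENERIC in the sharp table `σ : PEv → ℝ` and the share table `φ : PEv → ℝ` (no `FactorRead`, no `sharpT` imported):
it defines the two key-family products, identifies them with the products over the tagged members (root cells
injective on the live components + members well formed), and reduces the witness's `priceM` sentence at
`FcM := LIVEOf`, `RfM := MULTOf` to ONE real inequality per member — the CHARGE
`credits (pcredit ∘ sh) G + (8∕E₂·totalCostT + 4·partnerAges) + credits (φ ∘ sh) G ≤ credits (σ ∘ sh) G` — which is
the owner's `credits_add_discount_le_sharps` (row S21 (a)) with the fibre share booked (his `RoundingRoomF`, M5-4a).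

WHAT.  §1 `memberPrice` (the `priceM` factor, named; bridge `memberPrice_eq_priceN_gmap`), **`liveSharp`** (tagged) ∕
**`liveSharpN`** (flat, node sums) ∕ `liveSharp_eq_liveSharpN_gmap` (WF); §2 **`LIVEOf C K R u σ k := ∏_{w ∈ k}
liveSharpN … w.2.1`**, **`MULTOf φ k := ∏_{w ∈ k} exp (nsum φ w.2.1)`**, positivity; `prod_memOf_eq_prod_liveC` ∕
`prod_kmemOf_eq_prod_liveC` (any letter, `cell_inj`); **`LIVEOf_kmemOf_eq_prod_liveC`** ∕ `…_eq_prod_memOf`,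
**`MULTOf_kmemOf_eq_prod_liveC`** ∕ `…_eq_prod_memOf` (`cell_inj` + members WF); §3 **`liveSharp_mul_exp_le_memberPrice`**
(the charge ⇒ `LIVE♯ · e^{credits (φ ∘ sh)} ≤ memberPrice sh O C K 1 1 R g 0 u`), and **`priceM_of_keys_of_charge`**: the
per-member charge on the live components ⇒
`LIVEOf … (kmemOf …) * MULTOf φ (kmemOf …) ≤ ∏ q ∈ memOf …, pshapeTH Prod.fst O C 1 1 R g 0 (costT …) q.2 * e^{birthWT …} * e^{−(…)}`
— the field `priceM` ∕ `priceM′` of `CountRoadWitnessT3bWTVS`, literally, at `FcM := LIVEOf`, `RfM := MULTOf`.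

HONEST.  Bookkeeping identities and one `exp`-monotonicity step on OUR model objects; no reading of Bałaban, no
estimate; the CHARGE is a HYPOTHESIS here (the owner's M5-4a `RoundingRoomF` road supplies it), and every IR-45-1 ∕
R-OWNER-46-1 display (`HistRead`, `FactorRead`, `RoundingRoomF`, (ρ) `FibreMass`, `W∞`, the volume calibration) stays an
R-class hypothesis of the custodian's module P; headline p224237 ∕ E7T ∕ the V- and VS-headlines UNCHANGED BY NAME;
NE7b NOT PRINTED ∕ NOT PROVED; spine 0∕9.  HONEST DEPENDENCY (cell): continuum YM on T⁴ ⇐ BetaPertH ∧ nine spine estimates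
(0/9 proved); BetaPertH ⇐ (D1) ∧ (D4) ∧ CAP+tail; G-an2-4 gates asym, D1 and NE2/3/4.  This file changes none of it. -/

open Finset
open Literature.MathematicalPhysics.QuantumFieldTheory.Balaban1983to89
open T4PersistenceDictionary T4PrintedShapeBanking T4TaggedShapeBanking T4BankedInduction T4PartnerMultiplicity
open Summit.QuantumFields.BalabanUV.T4Continuum.LateMergers
open Summit.QuantumFields.BalabanUV.T4Continuum.HistoryConstants
open Summit.QuantumFields.BalabanUV.T4Continuum.HistoryBankingLE
open Summit.QuantumFields.BalabanUV.T4Continuum.HistoryBankingVolumePlug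
open Summit.QuantumFields.BalabanUV.T4Continuum.ZoneSkeleton
open Summit.QuantumFields.BalabanUV.T4Continuum.HistoryGen
open Summit.QuantumFields.BalabanUV.T4Continuum.HistoryAssemblyPedigree
open Summit.QuantumFields.BalabanUV.T4Continuum.HistoryAssemblyMultKey
open Summit.QuantumFields.BalabanUV.T4Continuum.HistoryPriceNodeSum

namespace Summit.QuantumFields.BalabanUV.T4Continuum.HistoryPriceKeys

noncomputable section

/-! ## §1 The per-member letters: the price factor and the sharp live factor, tagged and flat -/

section Letters

variable {ε : Type*} [DecidableEq ε]

/-- **THE PER-MEMBER PRICE** of a tagged genealogy (the factor of the VS-witness's `priceM` ∕ `priceM′` at one live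
member; `Δ := 1`, `Λ′ := 1`, `D := 0` there): print-priced shape at `κ := costT sh C K R`, the weighted class remainder
`e^{birthWT sh u G}`, the displayed discount `e^{−(8∕E₂·totalCostT + 4·partnerAges)}`. [folklore] -/
def memberPrice (sh : ε → PEv) (O : PrintedO1s) (C : T4PrintedShapeBanking.Consts) (K : ℕ) (Δ Λ' : ℝ) (R : ℕ → ℕ)
    (g : ℕ → ℝ) (D : ℕ) (u : ℕ → ℝ) (G : Gen ε) : ℝ :=
  pshapeTH sh O C Δ Λ' R g D (costT sh C K R) G * Real.exp (birthWT sh u G) *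
    Real.exp (-(8 / C.E₂ * totalCostT sh C K R G + 4 * (partnerAges (PEv.step ∘ sh) G : ℝ)))

/-- **ON A WELL-FORMED TAGGED GENEALOGY THE PER-MEMBER PRICE IS THE FLAT PRICE OF ITS FLATTENING** (module A).
[folklore] -/
theorem memberPrice_eq_priceN_gmap {sh : ε → PEv} {O : PrintedO1s} {C : T4PrintedShapeBanking.Consts} {K : ℕ}
    (Δ Λ' : ℝ) {R : ℕ → ℕ} {g : ℕ → ℝ} (D : ℕ) (u : ℕ → ℝ) {W' : ε → ℕ} {G : Gen ε} (hG : G.WF W') :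
    memberPrice sh O C K Δ Λ' R g D u G = priceN O C K Δ Λ' R g D u (gmap sh G) :=
  priceFactor_eq_priceN_gmap Δ Λ' D u hG

/-- **THE SHARP LIVE FACTOR** of a tagged genealogy: volume in the booked-cost currency at `κ := costT sh`, the weighted
class remainder, and the SHARP per-letter credits `e^{−credits (σ ∘ sh) G}` — brick B's live factor one step up the
credit chain (`evProd fB fR ≤ e^{−Σ sharpT}` under `FactorRead`), region-free, hence key-readable. [folklore] -/
def liveSharp (sh : ε → PEv) (C : T4PrintedShapeBanking.Consts) (K : ℕ) (R : ℕ → ℕ) (u : ℕ → ℝ) (σ : PEv → ℝ)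
    (G : Gen ε) : ℝ :=
  Real.exp (lifeCost (dictWT sh R C.n₁) (costT sh C K R) G) * Real.exp (birthWT sh u G) *
    Real.exp (-credits (σ ∘ sh) G)

/-- the sharp live factor is positive [folklore] -/
theorem liveSharp_pos (sh : ε → PEv) (C : T4PrintedShapeBanking.Consts) (K : ℕ) (R : ℕ → ℕ) (u : ℕ → ℝ) (σ : PEv → ℝ)
    (G : Gen ε) : 0 < liveSharp sh C K R u σ G := by
  unfold liveSharp; positivity

/-- **THE FLAT SHARP LIVE FACTOR** of a key letter `G : Gen PEv`: the same three exponentials with node sums (module A's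
`lifeCostN` at `D := 0`, `birthWN`, `nsum σ`). [folklore] -/
def liveSharpN (C : T4PrintedShapeBanking.Consts) (K : ℕ) (R : ℕ → ℕ) (u : ℕ → ℝ) (σ : PEv → ℝ) (G : Gen PEv) : ℝ :=
  Real.exp (lifeCostN C K R 0 G) * Real.exp (birthWN u G) * Real.exp (-nsum σ G)

/-- the flat sharp live factor is positive [folklore] -/
theorem liveSharpN_pos (C : T4PrintedShapeBanking.Consts) (K : ℕ) (R : ℕ → ℕ) (u : ℕ → ℝ) (σ : PEv → ℝ) (G : Gen PEv) :
    0 < liveSharpN C K R u σ G := by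
  unfold liveSharpN; positivity

/-- **ON A WELL-FORMED TAGGED GENEALOGY THE SHARP LIVE FACTOR IS THE FLAT ONE OF ITS FLATTENING** (module A's bridges
at `D := 0` and `credit := σ`). [folklore] -/
theorem liveSharp_eq_liveSharpN_gmap {sh : ε → PEv} {C : T4PrintedShapeBanking.Consts} {K : ℕ} {R : ℕ → ℕ} (u : ℕ → ℝ)
    (σ : PEv → ℝ) {W' : ε → ℕ} {G : Gen ε} (hG : G.WF W') :
    liveSharp sh C K R u σ G = liveSharpN C K R u σ (gmap sh G) := by
  have hlc := lifeCost_eq_lifeCostN_gmap (sh := sh) (C := C) (K := K) (R := R) 0 hG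
  rw [padW_zero] at hlc
  unfold liveSharp liveSharpN
  rw [hlc, birthWT_eq_birthWN_gmap u hG, credits_eq_nsum _ hG, ← nsum_gmap sh σ G]

end Letters

/-! ## §2 The two key-family products and their identification with the products over the tagged members -/

section Keys

variable {γ δ : Type*}

/-- **THE LIVE PRODUCT OF A KEY FAMILY** (`FcM K` of R-OWNER-46-1, read on the key): the product of the flat sharp live
factors of its genealogy letters. [folklore] -/
def LIVEOf (C : T4PrintedShapeBanking.Consts) (K : ℕ) (R : ℕ → ℕ) (u : ℕ → ℝ) (σ : PEv → ℝ)
    (k : Finset (γ × Gen PEv × δ)) : ℝ :=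
  ∏ w ∈ k, liveSharpN C K R u σ w.2.1

/-- **THE FIBRE MULTIPLICITY OF A KEY FAMILY** (`RfM K := MULT K` of R-OWNER-46-1): the product of `exp` of the node sums
of a displayed per-letter share table `φ` over its genealogy letters. [folklore] -/
def MULTOf (φ : PEv → ℝ) (k : Finset (γ × Gen PEv × δ)) : ℝ :=
  ∏ w ∈ k, Real.exp (nsum φ w.2.1)

/-- the live product of a key family is positive [folklore] -/
theorem LIVEOf_pos (C : T4PrintedShapeBanking.Consts) (K : ℕ) (R : ℕ → ℕ) (u : ℕ → ℝ) (σ : PEv → ℝ)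
    (k : Finset (γ × Gen PEv × δ)) : 0 < LIVEOf C K R u σ k :=
  prod_pos fun w _ => liveSharpN_pos C K R u σ w.2.1

/-- the fibre multiplicity of a key family is positive [folklore] -/
theorem MULTOf_pos (φ : PEv → ℝ) (k : Finset (γ × Gen PEv × δ)) : 0 < MULTOf φ k :=
  prod_pos fun _ _ => Real.exp_pos _

end Keys

section Products

variable {ι α π γ δ : Type*} [DecidableEq α] [DecidableEq π] [DecidableEq γ] [DecidableEq δ]
  {ped : ℕ → ι → Pedigree α π} {liveC : ℕ → ι → Finset α} {cellOf : ℕ → ι → α → γ} {phys : ℕ → ι → α → δ}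
  {K : ℕ} {τ : ι}

omit [DecidableEq δ] in
/-- **A PRODUCT OVER THE MEMBER FAMILY IS THE PRODUCT OVER THE LIVE COMPONENTS** (distinct live components have distinct
root cells). [folklore] -/
theorem prod_memOf_eq_prod_liveC (hinj : Set.InjOn (cellOf K τ) (liveC K τ : Set α)) (F : Gen (Lab α π) → ℝ) :
    ∏ q ∈ memOf ped liveC cellOf K τ, F q.2 = ∏ c ∈ liveC K τ, F ((ped K τ).genT c) := by
  rw [memOf, prod_image fun c hc c' hc' h => hinj hc hc' (congrArg Prod.fst h)]

omit [DecidableEq α] [DecidableEq π] in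
/-- **A PRODUCT OVER THE KEY FAMILY IS THE PRODUCT OVER THE LIVE COMPONENTS** (same injectivity). [folklore] -/
theorem prod_kmemOf_eq_prod_liveC (hinj : Set.InjOn (cellOf K τ) (liveC K τ : Set α)) (F : Gen PEv → ℝ) :
    ∏ w ∈ kmemOf ped liveC cellOf phys K τ, F w.2.1 = ∏ c ∈ liveC K τ, F ((ped K τ).gen c) := by
  rw [kmemOf, prod_image fun c hc c' hc' h => hinj hc hc' (congrArg Prod.fst h)]
  rfl

variable {C : T4PrintedShapeBanking.Consts} {R : ℕ → ℕ} {u : ℕ → ℝ} {σ φ : PEv → ℝ}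

/-- **THE LIVE PRODUCT OF THE KEY FAMILY IS THE PRODUCT OF THE SHARP LIVE FACTORS OVER THE LIVE COMPONENTS**
(`cell_inj` + members well formed). [folklore] -/
theorem LIVEOf_kmemOf_eq_prod_liveC (hinj : Set.InjOn (cellOf K τ) (liveC K τ : Set α)) {W' : α → Lab α π → ℕ}
    (hWF : ∀ c ∈ liveC K τ, ((ped K τ).genT c).WF (W' c)) :
    LIVEOf C K R u σ (kmemOf ped liveC cellOf phys K τ) =
      ∏ c ∈ liveC K τ, liveSharp Prod.fst C K R u σ ((ped K τ).genT c) := by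
  unfold LIVEOf
  rw [prod_kmemOf_eq_prod_liveC hinj]
  exact prod_congr rfl fun c hc => (liveSharp_eq_liveSharpN_gmap u σ (hWF c hc)).symm

/-- **… AND OVER THE MEMBER FAMILY.** [folklore] -/
theorem LIVEOf_kmemOf_eq_prod_memOf (hinj : Set.InjOn (cellOf K τ) (liveC K τ : Set α)) {W' : α → Lab α π → ℕ}
    (hWF : ∀ c ∈ liveC K τ, ((ped K τ).genT c).WF (W' c)) :
    LIVEOf C K R u σ (kmemOf ped liveC cellOf phys K τ) =
      ∏ q ∈ memOf ped liveC cellOf K τ, liveSharp Prod.fst C K R u σ q.2 := by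
  rw [LIVEOf_kmemOf_eq_prod_liveC hinj hWF, prod_memOf_eq_prod_liveC hinj]

/-- **THE FIBRE MULTIPLICITY OF THE KEY FAMILY IS THE PRODUCT OF `e^{credits (φ ∘ Prod.fst)}` OVER THE LIVE COMPONENTS**
(node sum of the flattening = credits of the tagged member, module A). [folklore] -/
theorem MULTOf_kmemOf_eq_prod_liveC (hinj : Set.InjOn (cellOf K τ) (liveC K τ : Set α)) {W' : α → Lab α π → ℕ}
    (hWF : ∀ c ∈ liveC K τ, ((ped K τ).genT c).WF (W' c)) :
    MULTOf φ (kmemOf ped liveC cellOf phys K τ) =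
      ∏ c ∈ liveC K τ, Real.exp (credits (φ ∘ Prod.fst) ((ped K τ).genT c)) := by
  unfold MULTOf
  rw [prod_kmemOf_eq_prod_liveC hinj (fun G => Real.exp (nsum φ G))]
  refine prod_congr rfl fun c hc => ?_
  rw [credits_eq_nsum _ (hWF c hc), ← nsum_gmap Prod.fst φ ((ped K τ).genT c)]
  rfl

/-- **… AND OVER THE MEMBER FAMILY.** [folklore] -/
theorem MULTOf_kmemOf_eq_prod_memOf (hinj : Set.InjOn (cellOf K τ) (liveC K τ : Set α)) {W' : α → Lab α π → ℕ}
    (hWF : ∀ c ∈ liveC K τ, ((ped K τ).genT c).WF (W' c)) :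
    MULTOf φ (kmemOf ped liveC cellOf phys K τ) =
      ∏ q ∈ memOf ped liveC cellOf K τ, Real.exp (credits (φ ∘ Prod.fst) q.2) := by
  rw [MULTOf_kmemOf_eq_prod_liveC hinj hWF,
    prod_memOf_eq_prod_liveC hinj (fun G => Real.exp (credits (φ ∘ Prod.fst) G))]

/-- **THE ONE-SIDED LIVE-COMPONENT FORM FOR `upM`**: `∏_{c ∈ liveC} LIVE♯(genT c) ≤ LIVEOf … (kmemOf …)` (in fact equal);
the custodian chains brick B's `weight ≤ LIVE_true·DEAD·rest` and `LIVE_true ≤ LIVE♯` (`evProd_le_exp_neg_sharps`) in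
front of it. [folklore] -/
theorem prod_liveC_liveSharp_le_LIVEOf (hinj : Set.InjOn (cellOf K τ) (liveC K τ : Set α)) {W' : Lab α π → ℕ}
    (hWF : ∀ c ∈ liveC K τ, ((ped K τ).genT c).WF W') :
    ∏ c ∈ liveC K τ, liveSharp Prod.fst C K R u σ ((ped K τ).genT c) ≤
      LIVEOf C K R u σ (kmemOf ped liveC cellOf phys K τ) :=
  (LIVEOf_kmemOf_eq_prod_liveC hinj (W' := fun _ => W') hWF).ge

end Products

/-! ## §3 The `priceM` sentence at `FcM := LIVEOf`, `RfM := MULTOf` from the per-member CHARGE -/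

section Charge

variable {ε : Type*} [DecidableEq ε] {sh : ε → PEv} {O : PrintedO1s} {C : T4PrintedShapeBanking.Consts} {K : ℕ}
  {R : ℕ → ℕ} {g : ℕ → ℝ} {u : ℕ → ℝ} {σ φ : PEv → ℝ}

/-- **PER MEMBER: THE CHARGE GIVES `LIVE♯ · e^{fibre share} ≤ PRICE`.**  If the booked credits, the displayed discount and
the fibre share are together at most the sharp credits —
`credits (pcredit ∘ sh) G + (8∕E₂·totalCostT + 4·partnerAges) + credits (φ ∘ sh) G ≤ credits (σ ∘ sh) G` (the owner's
`credits_add_discount_le_sharps` with the share booked) — then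
`liveSharp … σ G · e^{credits (φ ∘ sh) G} ≤ memberPrice sh O C K 1 1 R g 0 u G`. [folklore] -/
theorem liveSharp_mul_exp_le_memberPrice {G : Gen ε}
    (hch : credits (pcredit O C g ∘ sh) G +
        (8 / C.E₂ * totalCostT sh C K R G + 4 * (partnerAges (PEv.step ∘ sh) G : ℝ)) + credits (φ ∘ sh) G ≤
      credits (σ ∘ sh) G) :
    liveSharp sh C K R u σ G * Real.exp (credits (φ ∘ sh) G) ≤ memberPrice sh O C K 1 1 R g 0 u G := by
  have key : Real.exp (-credits (σ ∘ sh) G) * Real.exp (credits (φ ∘ sh) G) ≤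
      Real.exp (-credits (pcredit O C g ∘ sh) G) *
        Real.exp (-(8 / C.E₂ * totalCostT sh C K R G + 4 * (partnerAges (PEv.step ∘ sh) G : ℝ))) := by
    rw [← Real.exp_add, ← Real.exp_add]
    exact Real.exp_le_exp.2 (by linarith)
  have h0 : 0 ≤ Real.exp (lifeCost (dictWT sh R C.n₁) (costT sh C K R) G) * Real.exp (birthWT sh u G) := by positivity
  have hpad : padW (dictWT sh R C.n₁) 0 = dictWT sh R C.n₁ := padW_zero _
  unfold liveSharp memberPrice pshapeTH
  rw [hpad, one_pow, one_mul, one_mul]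
  calc Real.exp (lifeCost (dictWT sh R C.n₁) (costT sh C K R) G) * Real.exp (birthWT sh u G) *
          Real.exp (-credits (σ ∘ sh) G) * Real.exp (credits (φ ∘ sh) G)
        = Real.exp (lifeCost (dictWT sh R C.n₁) (costT sh C K R) G) * Real.exp (birthWT sh u G) *
            (Real.exp (-credits (σ ∘ sh) G) * Real.exp (credits (φ ∘ sh) G)) := by ring
    _ ≤ Real.exp (lifeCost (dictWT sh R C.n₁) (costT sh C K R) G) * Real.exp (birthWT sh u G) *
            (Real.exp (-credits (pcredit O C g ∘ sh) G) *
              Real.exp (-(8 / C.E₂ * totalCostT sh C K R G + 4 * (partnerAges (PEv.step ∘ sh) G : ℝ)))) :=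
          mul_le_mul_of_nonneg_left key h0
    _ = _ := by ring

end Charge

section PriceM

variable {ι α π γ δ : Type*} [DecidableEq α] [DecidableEq π] [DecidableEq γ] [DecidableEq δ]
  {ped : ℕ → ι → Pedigree α π} {liveC : ℕ → ι → Finset α} {cellOf : ℕ → ι → α → γ} {phys : ℕ → ι → α → δ}
  {K : ℕ} {τ : ι} {O : PrintedO1s} {C : T4PrintedShapeBanking.Consts} {R : ℕ → ℕ} {g : ℕ → ℝ} {u : ℕ → ℝ}
  {σ φ : PEv → ℝ}

/-- **THE `priceM` SENTENCE OF THE VS-WITNESS AT `FcM := LIVEOf`, `RfM := MULTOf` FROM THE PER-MEMBER CHARGE** (module B′'s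
headline).  Hypotheses: distinct live components have distinct root cells (`cell_inj`); the members are well formed
(one table; `wf_genT_pedMV`); the CHARGE holds at every live component (the owner's `RoundingRoomF` road).  Conclusion:
the field `priceM` ∕ `priceM′` of `CountRoadWitnessT3bWTVS`, literally, with `FcM K := LIVEOf C K (R K) (uV K) (σ K)`,
`RfM K := MULTOf (φ K)`, both read on ONE pedigree family. [folklore] -/
theorem priceM_of_keys_of_charge (hinj : Set.InjOn (cellOf K τ) (liveC K τ : Set α)) {W' : Lab α π → ℕ}
    (hWF : ∀ c ∈ liveC K τ, ((ped K τ).genT c).WF W')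
    (hch : ∀ c ∈ liveC K τ,
      credits (pcredit O C g ∘ Prod.fst) ((ped K τ).genT c) +
          (8 / C.E₂ * totalCostT Prod.fst C K R ((ped K τ).genT c) +
            4 * (partnerAges (PEv.step ∘ Prod.fst) ((ped K τ).genT c) : ℝ)) +
          credits (φ ∘ Prod.fst) ((ped K τ).genT c) ≤
        credits (σ ∘ Prod.fst) ((ped K τ).genT c)) :
    LIVEOf C K R u σ (kmemOf ped liveC cellOf phys K τ) * MULTOf φ (kmemOf ped liveC cellOf phys K τ) ≤
      ∏ q ∈ memOf ped liveC cellOf K τ,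
        pshapeTH Prod.fst O C 1 1 R g 0 (costT Prod.fst C K R) q.2 * Real.exp (birthWT Prod.fst u q.2) *
          Real.exp (-(8 / C.E₂ * totalCostT Prod.fst C K R q.2 + 4 * (partnerAges (PEv.step ∘ Prod.fst) q.2 : ℝ))) := by
  rw [LIVEOf_kmemOf_eq_prod_liveC hinj (W' := fun _ => W') hWF,
    MULTOf_kmemOf_eq_prod_liveC hinj (W' := fun _ => W') hWF, ← prod_mul_distrib,
    prod_memOf_eq_prod_liveC hinj
      (fun G => pshapeTH Prod.fst O C 1 1 R g 0 (costT Prod.fst C K R) G * Real.exp (birthWT Prod.fst u G) *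
        Real.exp (-(8 / C.E₂ * totalCostT Prod.fst C K R G + 4 * (partnerAges (PEv.step ∘ Prod.fst) G : ℝ))))]
  exact prod_le_prod (fun c _ => mul_nonneg (liveSharp_pos _ _ _ _ _ _ _).le (Real.exp_pos _).le)
    fun c hc => liveSharp_mul_exp_le_memberPrice (hch c hc)

/-- the same with the right-hand side written through `memberPrice`. [folklore] -/
theorem LIVEOf_mul_MULTOf_le_prod_memberPrice (hinj : Set.InjOn (cellOf K τ) (liveC K τ : Set α)) {W' : Lab α π → ℕ}
    (hWF : ∀ c ∈ liveC K τ, ((ped K τ).genT c).WF W')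
    (hch : ∀ c ∈ liveC K τ,
      credits (pcredit O C g ∘ Prod.fst) ((ped K τ).genT c) +
          (8 / C.E₂ * totalCostT Prod.fst C K R ((ped K τ).genT c) +
            4 * (partnerAges (PEv.step ∘ Prod.fst) ((ped K τ).genT c) : ℝ)) +
          credits (φ ∘ Prod.fst) ((ped K τ).genT c) ≤
        credits (σ ∘ Prod.fst) ((ped K τ).genT c)) :
    LIVEOf C K R u σ (kmemOf ped liveC cellOf phys K τ) * MULTOf φ (kmemOf ped liveC cellOf phys K τ) ≤
      ∏ q ∈ memOf ped liveC cellOf K τ, memberPrice Prod.fst O C K 1 1 R g 0 u q.2 :=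
  priceM_of_keys_of_charge hinj hWF hch

end PriceM

end

end Summit.QuantumFields.BalabanUV.T4Continuum.HistoryPriceKeys
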